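import Mathlib.Analysis.Calculus.ContDiff.Basic
import Mathlib.Analysis.Calculus.Taylor
import Mathlib.GroupTheory.Perm.Fin
import Literature.Analysis.Calculus.MixedPartialDerivWithin
import HarnessLib

/-!
# Taylor's formula with Lagrange remainder along a segment WITHIN a convex set; the binomial expansion of a
# symmetric multilinear map

Topic `Literature/Analysis/Calculus` (everything proved; no definitions, no named facts).  Two classical
ingredients of the finite Taylor expansion of a function of SEVERAL variables about a point that may lie on the
BOUNDARY of its (convex) domain of smoothness — the situation of one-sided expansion parameters:

* §1 **`map_const_add_eq_sum_choose_of_symmetric`** — for a SYMMETRIC continuous `j`-linear map `M`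
  (`M(v ∘ σ) = M(v)` for all permutations `σ`), the binomial expansion on two vectors
  `M(a + b, …, a + b) = Σ_{α=0}^{j} C(j, α) · M(a, …, a, b, …, b)` (`α` copies of `a` first, then `j − α`
  copies of `b`; Coleman, *Calculus on Normed Vector Spaces*, Appendix to Ch. 5, proof of Thm. 5.9:
  `φ(x + h) − φ(x) = Σ_{i=1}^{k} C(k, i) φ̃(x^{k−i}, h^i)`).  Proof by induction on `j` through `M(cons · ·)`
  (`ContinuousMultilinearMap.cons_add`, `curryLeft`), moving a leading `b` behind the `a`-block with the cycle
  `Fin.cycleRange`, and Pascal's rule.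
* §2 **`iteratedDerivWithin_segment_eq`** — for `g` of class `C^n` within a convex set `S` of unique
  differentiability and `a, a + x ∈ S`: `∂^i_{s,[0,1]}[g(a + s x)] = D^i_S g(a + s x)(x, …, x)` (`i ≤ n`), and
  **`taylor_lagrange_segment_within`** — Taylor's formula with Lagrange remainder (Coleman Thm. 5.3) in the
  within-`S` form: for `g : E → ℝ` of class `C^{k+1}` within `S`,
  `g(a + x) = Σ_{i ≤ k} D^i_S g(a)(x^i)/i! + D^{k+1}_S g(a + θx)(x^{k+1})/(k+1)!` for some `θ ∈ (0, 1)`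
  (Mathlib's one-variable `taylor_mean_remainder_lagrange` on `[0, 1]` + the affine chain rule within sets
  `MixedPartialDerivWithin.iteratedFDerivWithin_comp_affine` + `iteratedFDerivWithin_subset`).
* §3 (v1.1) **`taylor_lagrange_mixed_partials_prod`** / **`taylor_lagrange_mixed_partials_openFst`** — §2 on a
  convex PRODUCT `I ×ˢ Λ ⊆ ℝ²` with the Taylor polynomial written in the mixed partials
  `∂^α_{u,I}∂^{i−α}_{s,Λ}Φ(e₀, t₀)` (coefficients `e^α λ^{i−α}/(α!(i−α)!)`, the indexing of a double power series
  `Σ e^α λ^β c_{(α,β)}`) via §1b and `MixedPartialDerivWithin` §5–§6; the `_openFst` form (open `I`) has the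
  unconstrained `e`-derivatives.

Consumer: the perturbative sum (1.5) of Bałaban's `(Higgs)₂,₃` III as the Taylor polynomial of `E_k(e′, λ′)` at
`(0, 0⁺)` on the slab `ℝ × [0, δ]` with an explicit remainder (`Balaban1983to89/B3Eq15TaylorRemainder`); filed by
the lit-balaban typer (statement-level skeleton of published theorems with citation tags; proofs where landed;
nothing here is a claim about the Yang–Mills mass gap).  v1.1 (§3, APPEND-ONLY; §1–§2 byte-identical): the
mixed-partials form on a product set, generalising the file-local `taylor_slab` of `Balaban1983to89/B3Eq119JointSmooth`
(the two-variable Taylor formula of the two-point function (1.19) in `(e, λ)` at `(0, 0⁺)`); filed by lit-balaban p39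
at the typer's request.

## Mathlib / tree search

Mathlib: `taylor_mean_remainder_lagrange` (one real variable), `MultilinearMap.map_add_univ` (expansion over all
subsets, no symmetry), `ContinuousMultilinearMap.cons_add`, `Fin.cycleRange`, `Equiv.Perm.decomposeFin`; no
multivariable Taylor formula with remainder and no binomial formula for symmetric multilinear maps (searched
`taylor.*segment`, `choose.*ContinuousMultilinearMap`, `symmetric.*multilinear`).  Tree: `RayTaylor`
(`norm_sub_raySum_le`, GLOBAL `C^{N+1}` maps, norm bound, rays from `0`), `TaylorSegment` (order two),
`IteratedFDerivSymmetric` (symmetry of `D^m f`), `MixedPartialDerivWithin` (within-slab partials; §2 uses its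
affine chain rule).

## References

* R. Coleman, *Calculus on Normed Vector Spaces*, Universitext, Springer 2012: §5.1 Thm. 5.3 (Taylor's formula along
  `g(t) = f(a + tx)`, `dⁱg/dtⁱ(t) = f^{(i)}(a + tx)(xⁱ)`, Lagrange form of the remainder), Appendix to Ch. 5
  "Homogeneous polynomials", proof of Thm. 5.9 (binomial expansion of a symmetric `k`-linear map). [Coleman2012]
  (Held: `book:coleman2012-calculus-normed-vector-spaces`; numbers read from the text layer.)
-/

noncomputable section

open Set Function Filter Finset
open scoped Topology ContDiff BigOperators

namespace Literature.Analysis.Calculus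

variable {𝕜 : Type*} [NontriviallyNormedField 𝕜]

/-! ## §1 The binomial expansion of a symmetric multilinear map on two vectors -/

section SymmetricBinomial

variable {E G : Type*} [NormedAddCommGroup E] [NormedSpace 𝕜 E] [NormedAddCommGroup G] [NormedSpace 𝕜 G]

/-- Prepending `a` to the block tuple `(a^α, b^{j−α})` gives the block tuple `(a^{α+1}, b^{j−α})`. [folklore] -/
private theorem cons_block {X : Type*} (a b : X) (α : ℕ) {j : ℕ} :
    (Fin.cons a (fun i : Fin j => if (i : ℕ) < α then a else b) : Fin (j + 1) → X)
      = fun i : Fin (j + 1) => if (i : ℕ) < α + 1 then a else b := by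
  funext i
  refine Fin.cases ?_ (fun k => ?_) i
  · simp
  · simp only [Fin.cons_succ, Fin.val_succ, Nat.succ_lt_succ_iff]

/-- Prepending `b` to the block tuple `(a^α, b^{j−α})` and rotating the first `α + 1` slots (`Fin.cycleRange α`)
gives the block tuple `(a^α, b^{j+1−α})`. [folklore] -/
private theorem cons_block_comp_cycleRange {X : Type*} (a b : X) {j α : ℕ} (hα : α ≤ j) :
    (Fin.cons b (fun i : Fin j => if (i : ℕ) < α then a else b) : Fin (j + 1) → X)
        ∘ (Fin.cycleRange (⟨α, Nat.lt_succ_of_le hα⟩ : Fin (j + 1)))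
      = fun i : Fin (j + 1) => if (i : ℕ) < α then a else b := by
  funext k
  simp only [Function.comp_apply]
  rcases lt_trichotomy (k : ℕ) α with hk | hk | hk
  · have hlt : k < (⟨α, Nat.lt_succ_of_le hα⟩ : Fin (j + 1)) := Fin.lt_def.2 hk
    have hval : ((Fin.cycleRange (⟨α, Nat.lt_succ_of_le hα⟩ : Fin (j + 1)) k : Fin (j + 1)) : ℕ) = k + 1 :=
      Fin.coe_cycleRange_of_lt hlt
    have hk' : (k : ℕ) < j := lt_of_lt_of_le hk hα
    have e : Fin.cycleRange (⟨α, Nat.lt_succ_of_le hα⟩ : Fin (j + 1)) k = Fin.succ ⟨k, hk'⟩ :=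
      Fin.ext (by rw [hval, Fin.val_succ])
    rw [e, Fin.cons_succ, if_pos hk]
  · have e : k = ⟨α, Nat.lt_succ_of_le hα⟩ := Fin.ext hk
    rw [e, Fin.cycleRange_self, Fin.cons_zero, if_neg (lt_irrefl _)]
  · have hgt : (⟨α, Nat.lt_succ_of_le hα⟩ : Fin (j + 1)) < k := Fin.lt_def.2 hk
    rw [Fin.cycleRange_of_gt hgt]
    have hk0 : k ≠ 0 := by
      intro h
      rw [h, Fin.val_zero] at hk
      exact Nat.not_lt_zero _ hk
    obtain ⟨m, rfl⟩ := Fin.exists_succ_eq.2 hk0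
    rw [Fin.cons_succ, Fin.val_succ] at *
    rw [if_neg (by omega), if_neg (by omega)]

/-- A symmetric `(j+1)`-linear map is symmetric in its last `j` slots at fixed first argument (the permutation
`decomposeFin⁻¹(0, σ)` fixes `0` and acts by `σ` on the successors). [folklore] -/
private theorem map_cons_comp_perm {j : ℕ} (M : E [×(j + 1)]→L[𝕜] G)
    (hM : ∀ (v : Fin (j + 1) → E) (σ : Equiv.Perm (Fin (j + 1))), M (v ∘ σ) = M v) (a : E)
    (v : Fin j → E) (σ : Equiv.Perm (Fin j)) :
    M (Fin.cons a (v ∘ σ)) = M (Fin.cons a v) := by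
  have e : (Fin.cons a (v ∘ σ) : Fin (j + 1) → E)
      = (Fin.cons a v : Fin (j + 1) → E) ∘ (Equiv.Perm.decomposeFin.symm (0, σ)) := by
    funext i
    refine Fin.cases ?_ (fun k => ?_) i
    · rw [Function.comp_apply, Equiv.Perm.decomposeFin_symm_apply_zero, Fin.cons_zero, Fin.cons_zero]
    · rw [Function.comp_apply, Equiv.Perm.decomposeFin_symm_apply_succ, Equiv.swap_self, Equiv.refl_apply,
        Fin.cons_succ, Fin.cons_succ, Function.comp_apply]
  rw [e, hM]

/-- Pascal's rule, summed: `Σ_{α≤j} C(j,α) f(α+1) + Σ_{α≤j} C(j,α) f(α) = Σ_{β≤j+1} C(j+1,β) f(β)`. [folklore] -/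
private theorem pascal_sum (f : ℕ → G) (j : ℕ) :
    ∑ α ∈ Finset.range (j + 1), (j.choose α : 𝕜) • f (α + 1)
        + ∑ α ∈ Finset.range (j + 1), (j.choose α : 𝕜) • f α
      = ∑ β ∈ Finset.range (j + 2), ((j + 1).choose β : 𝕜) • f β := by
  rw [Finset.sum_range_succ' (fun β => ((j + 1).choose β : 𝕜) • f β)]
  simp only [Nat.choose_succ_succ, Nat.cast_add, add_smul, Finset.sum_add_distrib]
  rw [Finset.sum_range_succ' (fun α => (j.choose α : 𝕜) • f α),
    Finset.sum_range_succ (fun α => (j.choose (α + 1) : 𝕜) • f (α + 1)),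
    Nat.choose_succ_self, Nat.cast_zero, zero_smul, add_zero, Nat.choose_zero_right, Nat.choose_zero_right]
  abel

/-- **Binomial expansion of a symmetric multilinear map on two vectors**: for a continuous `j`-linear map `M`
with `M(v ∘ σ) = M(v)` for every permutation `σ` of the slots,
`M(a + b, …, a + b) = Σ_{α=0}^{j} C(j, α) · M(a, …, a, b, …, b)` (`α` copies of `a`, then `j − α` copies of `b`,
written as the tuple `i ↦ if i < α then a else b`).  Coleman's `φ(x+h) − φ(x) = Σ_{i=1}^{k} C(k,i) φ̃(x^{k−i}, hⁱ)`
for the symmetric `k`-linear `φ̃` with `φ(x) = φ̃(x^k)`. [cite: Coleman2012, App. Ch. 5 (proof of Thm. 5.9)] -/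
theorem map_const_add_eq_sum_choose_of_symmetric :
    ∀ {j : ℕ} (M : E [×j]→L[𝕜] G),
      (∀ (v : Fin j → E) (σ : Equiv.Perm (Fin j)), M (v ∘ σ) = M v) → ∀ a b : E,
        M (fun _ => a + b)
          = ∑ α ∈ Finset.range (j + 1), (j.choose α : 𝕜) • M (fun i : Fin j => if (i : ℕ) < α then a else b)
  | 0, M, hM, a, b => by
      rw [Finset.sum_range_one, Nat.choose_zero_right, Nat.cast_one, one_smul]
      congr 1
      funext i
      exact i.elim0
  | j + 1, M, hM, a, b => by
      have hMa := map_cons_comp_perm M hM a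
      have hMb := map_cons_comp_perm M hM b
      have IHa := map_const_add_eq_sum_choose_of_symmetric (M.curryLeft a)
        (fun v σ => by rw [ContinuousMultilinearMap.curryLeft_apply, ContinuousMultilinearMap.curryLeft_apply, hMa])
        a b
      have IHb := map_const_add_eq_sum_choose_of_symmetric (M.curryLeft b)
        (fun v σ => by rw [ContinuousMultilinearMap.curryLeft_apply, ContinuousMultilinearMap.curryLeft_apply, hMb])
        a b
      simp only [ContinuousMultilinearMap.curryLeft_apply] at IHa IHb
      have h0 : (fun _ : Fin (j + 1) => a + b) = Fin.cons (a + b) (fun _ : Fin j => a + b) := by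
        funext i
        refine Fin.cases ?_ (fun k => ?_) i <;> simp
      rw [h0, M.cons_add, IHa, IHb]
      have ha : ∀ α ∈ Finset.range (j + 1),
          (j.choose α : 𝕜) • M (Fin.cons a (fun i : Fin j => if (i : ℕ) < α then a else b))
            = (j.choose α : 𝕜) • M (fun i : Fin (j + 1) => if (i : ℕ) < α + 1 then a else b) := by
        intro α _
        rw [cons_block]
      have hb : ∀ α ∈ Finset.range (j + 1),
          (j.choose α : 𝕜) • M (Fin.cons b (fun i : Fin j => if (i : ℕ) < α then a else b))
            = (j.choose α : 𝕜) • M (fun i : Fin (j + 1) => if (i : ℕ) < α then a else b) := by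
        intro α hα
        rw [← cons_block_comp_cycleRange a b (Nat.lt_succ_iff.1 (Finset.mem_range.1 hα)), hM]
      rw [Finset.sum_congr rfl ha, Finset.sum_congr rfl hb]
      exact pascal_sum (𝕜 := 𝕜) (fun β => M (fun i : Fin (j + 1) => if (i : ℕ) < β then a else b)) j

end SymmetricBinomial

/-! ## §1b The expansion with scalars -/

section Bookkeeping

variable {E G : Type*} [NormedAddCommGroup E] [NormedSpace 𝕜 E] [NormedAddCommGroup G] [NormedSpace 𝕜 G]

/-- `∏_{k < j} (if k < α then s else t) = s^α t^{j−α}` for `α ≤ j`. [folklore] -/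
private theorem prod_ite_lt_eq_pow {j α : ℕ} (hα : α ≤ j) (s t : 𝕜) :
    (∏ k : Fin j, if (k : ℕ) < α then s else t) = s ^ α * t ^ (j - α) := by
  rw [Fin.prod_univ_eq_prod_range (fun k => if k < α then s else t) j]
  conv_lhs => rw [← Nat.add_sub_cancel' hα, Finset.prod_range_add]
  rw [Finset.prod_eq_pow_card (b := s) (fun k hk => if_pos (Finset.mem_range.1 hk)),
    Finset.prod_eq_pow_card (b := t) (fun k _ => if_neg (by omega)), Finset.card_range, Finset.card_range]

/-- **Binomial expansion of a symmetric multilinear map, with scalars**: for `M` symmetric `j`-linear,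
`M(sa + tb, …, sa + tb) = Σ_{α=0}^{j} C(j,α) s^α t^{j−α} · M(a, …, a, b, …, b)` (`α` copies of `a`, then `b`'s).
[cite: Coleman2012, App. Ch. 5 (proof of Thm. 5.9)] -/
theorem map_const_add_smul_eq_sum_choose_of_symmetric {j : ℕ} (M : E [×j]→L[𝕜] G)
    (hM : ∀ (v : Fin j → E) (σ : Equiv.Perm (Fin j)), M (v ∘ σ) = M v) (a b : E) (s t : 𝕜) :
    M (fun _ => s • a + t • b)
      = ∑ α ∈ Finset.range (j + 1),
          ((j.choose α : 𝕜) * s ^ α * t ^ (j - α)) • M (fun i : Fin j => if (i : ℕ) < α then a else b) := by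
  rw [map_const_add_eq_sum_choose_of_symmetric M hM (s • a) (t • b)]
  refine Finset.sum_congr rfl fun α hα => ?_
  have hαj : α ≤ j := Nat.lt_succ_iff.1 (Finset.mem_range.1 hα)
  have e : (fun i : Fin j => if (i : ℕ) < α then s • a else t • b)
      = fun i : Fin j => (if (i : ℕ) < α then s else t) • (if (i : ℕ) < α then a else b) := by
    funext i
    split_ifs <;> rfl
  rw [e, M.map_smul_univ, prod_ite_lt_eq_pow hαj, smul_smul, mul_assoc]

end Bookkeeping

/-! ## §2 Taylor–Lagrange along a segment within a convex set -/

section Segment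

variable {E G : Type*} [NormedAddCommGroup E] [NormedSpace ℝ E] [NormedAddCommGroup G] [NormedSpace ℝ G]

/-- **Derivatives along a segment inside a convex set**: for `g` of class `C^n` within a convex set `S` of unique
differentiability, `a ∈ S`, `a + x ∈ S`, the function `s ↦ g(a + s•x)` on `[0, 1]` has
`∂^i_{s,[0,1]} g(a + s•x) = D^i_S g(a + s•x)(x, …, x)` (`i ≤ n`, `s ∈ [0, 1]`) — Coleman's `dⁱg/dtⁱ(t) = f^{(i)}(a+tx)(xⁱ)`
(proof of Thm. 5.3) in the within-`S` setting. [cite: Coleman2012, §5.1 Thm. 5.3 (proof)] -/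
theorem iteratedDerivWithin_segment_eq {g : E → G} {S : Set E} {n : WithTop ℕ∞} (hg : ContDiffOn ℝ n g S)
    (hS : UniqueDiffOn ℝ S) (hSc : Convex ℝ S) {a x : E} (ha : a ∈ S) (hax : a + x ∈ S) {i : ℕ}
    (hi : (i : WithTop ℕ∞) ≤ n) {t : ℝ} (ht : t ∈ Icc (0 : ℝ) 1) :
    iteratedDerivWithin i (fun s : ℝ => g (a + s • x)) (Icc 0 1) t
      = iteratedFDerivWithin ℝ i g S (a + t • x) fun _ => x := by
  set L : ℝ →L[ℝ] E := ContinuousLinearMap.toSpanSingleton ℝ x with hL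
  have hLs : ∀ s : ℝ, L s = s • x := fun s => ContinuousLinearMap.toSpanSingleton_apply _ _ _
  set J : Set ℝ := (fun s => a + L s) ⁻¹' S with hJ
  have hIccJ : Icc (0 : ℝ) 1 ⊆ J := fun s hs => by
    show a + L s ∈ S
    rw [hLs]
    exact hSc.add_smul_mem ha hax hs
  have hJc : Convex ℝ J := by
    intro s₁ hs₁ s₂ hs₂ μ ν hμ hν hμν
    show a + L (μ • s₁ + ν • s₂) ∈ S
    have e : a + L (μ • s₁ + ν • s₂) = μ • (a + L s₁) + ν • (a + L s₂) := by
      rw [hLs, hLs, hLs, smul_eq_mul, smul_eq_mul, smul_add, smul_add, smul_smul, smul_smul, add_smul]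
      have ha' : a = μ • a + ν • a := by rw [← add_smul, hμν, one_smul]
      conv_lhs => rw [ha']
      abel
    rw [e]
    exact hSc hs₁ hs₂ hμ hν hμν
  have hJu : UniqueDiffOn ℝ J := by
    refine uniqueDiffOn_convex hJc ⟨1 / 2, ?_⟩
    exact interior_mono hIccJ (by rw [interior_Icc]; exact ⟨by norm_num, by norm_num⟩)
  have hfJ : ContDiffOn ℝ n (fun s : ℝ => g (a + L s)) J :=
    hg.comp (contDiff_const.add L.contDiff).contDiffOn fun s hs => hs
  have hfun : (fun s : ℝ => g (a + s • x)) = fun s => g (a + L s) := by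
    funext s; rw [hLs]
  rw [iteratedDerivWithin_eq_iteratedFDerivWithin, hfun,
    iteratedFDerivWithin_subset hIccJ (uniqueDiffOn_Icc zero_lt_one) hJu (hfJ.of_le hi) ht,
    iteratedFDerivWithin_comp_affine hg hS a L hJu (hIccJ ht) hi,
    ContinuousMultilinearMap.compContinuousLinearMap_apply, hLs, hLs, one_smul]

/-- **Taylor's formula with Lagrange remainder along a segment, within a convex set** (Coleman Thm. 5.3 in the
within-`S` form): for `g : E → ℝ` of class `C^{k+1}` within a convex set `S` of unique differentiability and
`a, a + x ∈ S`, there is `θ ∈ (0, 1)` with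
`g(a + x) = Σ_{i ≤ k} (1/i!) D^i_S g(a)(x, …, x) + (1/(k+1)!) D^{k+1}_S g(a + θx)(x, …, x)` — all derivatives taken
WITHIN `S` (so `a` may lie on the boundary of `S`, e.g. a closed slab). [cite: Coleman2012, §5.1 Thm. 5.3] -/
theorem taylor_lagrange_segment_within {g : E → ℝ} {S : Set E} (hS : UniqueDiffOn ℝ S) (hSc : Convex ℝ S)
    {k : ℕ} (hg : ContDiffOn ℝ ((k + 1 : ℕ) : WithTop ℕ∞) g S) {a x : E} (ha : a ∈ S) (hax : a + x ∈ S) :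
    ∃ θ ∈ Ioo (0 : ℝ) 1,
      g (a + x) = ∑ i ∈ Finset.range (k + 1), ((i.factorial : ℝ))⁻¹ * iteratedFDerivWithin ℝ i g S a (fun _ => x)
        + (((k + 1).factorial : ℝ))⁻¹ * iteratedFDerivWithin ℝ (k + 1) g S (a + θ • x) (fun _ => x) := by
  set f : ℝ → ℝ := fun s => g (a + s • x) with hf
  have hmaps : MapsTo (fun s : ℝ => a + s • x) (Icc (0 : ℝ) 1) S := fun s hs => hSc.add_smul_mem ha hax hs
  have hfc : ContDiffOn ℝ ((k + 1 : ℕ) : WithTop ℕ∞) f (Icc 0 1) :=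
    hg.comp (contDiff_const.add (contDiff_id.smul contDiff_const)).contDiffOn hmaps
  have hfk : ContDiffOn ℝ (k : WithTop ℕ∞) f (uIcc 0 1) := by
    rw [Set.uIcc_of_le zero_le_one]
    exact hfc.of_le (by exact_mod_cast Nat.le_succ k)
  have hf' : DifferentiableOn ℝ (iteratedDerivWithin k f (uIcc 0 1)) (uIoo 0 1) := by
    rw [Set.uIcc_of_le zero_le_one, Set.uIoo_of_le zero_le_one]
    exact (hfc.differentiableOn_iteratedDerivWithin (by exact_mod_cast Nat.lt_succ_self k)
      (uniqueDiffOn_Icc zero_lt_one)).mono Ioo_subset_Icc_self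
  obtain ⟨θ, hθ, hrem⟩ := taylor_mean_remainder_lagrange (f := f) (x₀ := 0) (x := 1) (n := k) zero_ne_one hfk hf'
  rw [Set.uIoo_of_le zero_le_one] at hθ
  rw [Set.uIcc_of_le zero_le_one, taylor_within_apply] at hrem
  refine ⟨θ, hθ, ?_⟩
  have hθI : θ ∈ Icc (0 : ℝ) 1 := Ioo_subset_Icc_self hθ
  have h0I : (0 : ℝ) ∈ Icc (0 : ℝ) 1 := ⟨le_rfl, zero_le_one⟩
  have hk1 : (((k + 1 : ℕ) : ℕ) : WithTop ℕ∞) ≤ ((k + 1 : ℕ) : WithTop ℕ∞) := le_rfl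
  have hterm : ∀ i ∈ Finset.range (k + 1),
      ((i.factorial : ℝ)⁻¹ * (1 - 0) ^ i) • iteratedDerivWithin i f (Icc 0 1) 0
        = ((i.factorial : ℝ))⁻¹ * iteratedFDerivWithin ℝ i g S a (fun _ => x) := by
    intro i hi
    have hi' : (i : WithTop ℕ∞) ≤ ((k + 1 : ℕ) : WithTop ℕ∞) := by
      exact_mod_cast (Finset.mem_range.1 hi).le
    rw [sub_zero, one_pow, mul_one, smul_eq_mul, hf, iteratedDerivWithin_segment_eq hg hS hSc ha hax hi' h0I,
      zero_smul, add_zero]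
  rw [Finset.sum_congr rfl hterm, hf, iteratedDerivWithin_segment_eq hg hS hSc ha hax hk1 hθI, sub_zero, one_pow,
    mul_one] at hrem
  have e1 : f 1 = g (a + x) := by rw [hf]; simp only [one_smul]
  rw [← e1]
  rw [div_eq_mul_inv, mul_comm] at hrem
  linarith [hrem]

end Segment

/-! ## §3 Taylor–Lagrange within a product set `I ×ˢ Λ`, indexed by the mixed partials

(v1.1, APPEND-ONLY.)  §2 combined with the binomial expansion §1b and the within-symmetry / product-set slices of
`MixedPartialDerivWithin` §5–§6: for `Φ : ℝ × ℝ → ℝ` of class `C^{k+1}` within a convex product `I ×ˢ Λ` of two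
sets of unique differentiability and a base point `(e₀, t₀) ∈ I ×ˢ Λ` lying in
`closure (interior I) ×ˢ closure (interior Λ)`, Taylor's formula of order `k` in the increments `(e, λ)` with the
polynomial written in the MIXED PARTIALS `∂^α_{u,I}∂^{i−α}_{s,Λ}Φ(e₀, t₀)` and the coefficients
`e^α λ^{i−α}/(α!(i−α)!)` — the indexing of a double power series `Σ e^α λ^β c_{(α,β)}` (the form in which Bałaban's
`(Higgs)₂,₃` III prints its `(e, λ)`-expansions, e.g. (1.23) p. 417 *"δm² = Σ_{2≤α+2β≤4} e^α λ^β δm²_{(α,β)}"*) —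
and the Lagrange remainder `D^{k+1}_{I×Λ}Φ(e₀ + θe, t₀ + θλ)((e, λ)^{k+1})/(k+1)!`, `θ ∈ (0, 1)`: the fully-within
form `taylor_lagrange_mixed_partials_prod` and, for an OPEN first factor, `taylor_lagrange_mixed_partials_openFst`
with the unconstrained `e`-derivatives (the slab `I ×ˢ [0, δ)` at `t₀ = 0`; consumer
`Balaban1983to89/B3Eq119JointSmooth`, whose file-local `taylor_slab` is the case `(e₀, t₀) = (0, 0)`). -/

section MixedPartialsForm

/-- For `h : α + β = i` the block tuple `(u^α, v^{i−α})` on `Fin i` is the concatenation `Fin.append u^α v^β`, so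
the corresponding entries of `D^i_S Φ` and `D^{α+β}_S Φ` agree. [folklore] -/
private theorem iteratedFDerivWithin_ite_eq_append {X G : Type*} [NormedAddCommGroup X] [NormedSpace ℝ X]
    [NormedAddCommGroup G] [NormedSpace ℝ G] (Φ : X → G) (S : Set X) (p u v : X) {α β i : ℕ} (h : α + β = i) :
    iteratedFDerivWithin ℝ i Φ S p (fun k : Fin i => if (k : ℕ) < α then u else v)
      = iteratedFDerivWithin ℝ (α + β) Φ S p (Fin.append (fun _ : Fin α => u) (fun _ : Fin β => v)) := by
  subst h
  congr 1
  funext k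
  refine Fin.addCases (fun l => ?_) (fun l => ?_) k
  · rw [Fin.append_left, if_pos (by rw [Fin.val_castAdd]; exact l.isLt)]
  · rw [Fin.append_right, if_neg (by rw [Fin.val_natAdd]; omega)]

/-- **Taylor's formula with Lagrange remainder within a product set, in the mixed-partials indexing** (fully-within
form): for `Φ : ℝ × ℝ → ℝ` of class `C^{k+1}` within `I ×ˢ Λ` (`I`, `Λ` convex of unique differentiability), a
base point with `e₀ ∈ I ∩ closure (interior I)`, `t₀ ∈ Λ ∩ closure (interior Λ)`, and increments with
`e₀ + e ∈ I`, `t₀ + λ ∈ Λ`, there is `θ ∈ (0, 1)` with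
`Φ(e₀ + e, t₀ + λ) = Σ_{i ≤ k} Σ_{α ≤ i} e^α λ^{i−α}/(α!(i−α)!) · ∂^α_{u,I}∂^{i−α}_{s,Λ}Φ(e₀, t₀)
  + D^{k+1}_{I×Λ}Φ(e₀ + θe, t₀ + θλ)((e, λ), …, (e, λ))/(k+1)!`
(Coleman Thm. 5.3 along the segment within `I ×ˢ Λ`, §2; the `i`-th term `D^i_{I×Λ}Φ(e₀,t₀)((e,λ)^i)/i!` expanded
by the binomial formula for the symmetric `D^i` at a point of `closure (interior (I ×ˢ Λ))`, §1b, and its entries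
identified with the mixed partials, `MixedPartialDerivWithin` §6). (folklore, Mathlib-level)
[cite: Coleman2012, §5.1 Thm. 5.3] -/
theorem taylor_lagrange_mixed_partials_prod {Φ : ℝ × ℝ → ℝ} {I Λ : Set ℝ} (hIc : Convex ℝ I)
    (hIu : UniqueDiffOn ℝ I) (hΛc : Convex ℝ Λ) (hΛu : UniqueDiffOn ℝ Λ) {e₀ t₀ : ℝ} (he₀ : e₀ ∈ I)
    (he₀' : e₀ ∈ closure (interior I)) (ht₀ : t₀ ∈ Λ) (ht₀' : t₀ ∈ closure (interior Λ)) {k : ℕ}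
    (hΦ : ContDiffOn ℝ ((k + 1 : ℕ) : WithTop ℕ∞) Φ (I ×ˢ Λ)) {e lam : ℝ} (he : e₀ + e ∈ I)
    (hlam : t₀ + lam ∈ Λ) :
    ∃ θ ∈ Ioo (0 : ℝ) 1,
      Φ (e₀ + e, t₀ + lam) = ∑ i ∈ Finset.range (k + 1), ∑ α ∈ Finset.range (i + 1),
          (1 / ((α.factorial : ℝ) * ((i - α).factorial : ℝ)) * e ^ α * lam ^ (i - α)) *
            iteratedDerivWithin α (fun u => iteratedDerivWithin (i - α) (fun s => Φ (u, s)) Λ t₀) I e₀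
        + (((k + 1).factorial : ℝ))⁻¹ *
            iteratedFDerivWithin ℝ (k + 1) Φ (I ×ˢ Λ) (e₀ + θ * e, t₀ + θ * lam) (fun _ => (e, lam)) := by
  have hS : UniqueDiffOn ℝ (I ×ˢ Λ : Set (ℝ × ℝ)) := hIu.prod hΛu
  have hSc : Convex ℝ (I ×ˢ Λ : Set (ℝ × ℝ)) := hIc.prod hΛc
  have h0 : ((e₀, t₀) : ℝ × ℝ) ∈ (I ×ˢ Λ : Set (ℝ × ℝ)) := ⟨he₀, ht₀⟩
  have hx : ((e₀, t₀) : ℝ × ℝ) + (e, lam) ∈ (I ×ˢ Λ : Set (ℝ × ℝ)) := by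
    rw [Prod.mk_add_mk]; exact ⟨he, hlam⟩
  obtain ⟨θ, hθ, h⟩ := taylor_lagrange_segment_within hS hSc hΦ h0 hx
  refine ⟨θ, hθ, ?_⟩
  rw [Prod.mk_add_mk, Prod.smul_mk, smul_eq_mul, smul_eq_mul, Prod.mk_add_mk] at h
  rw [h]
  congr 1
  refine Finset.sum_congr rfl fun i hi => ?_
  have hik : ((i : ℕ) : WithTop ℕ∞) ≤ ((k + 1 : ℕ) : WithTop ℕ∞) := by exact_mod_cast (Finset.mem_range.1 hi).le
  -- symmetry of `D^i_{I×Λ} Φ(e₀,t₀)` and the binomial expansion on `e(1,0) + λ(0,1)`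
  have h00' : ((e₀, t₀) : ℝ × ℝ) ∈ closure (interior (I ×ˢ Λ : Set (ℝ × ℝ))) := by
    rw [interior_prod_eq, closure_prod_eq]; exact ⟨he₀', ht₀'⟩
  have hsymm : ∀ (v : Fin i → ℝ × ℝ) (σ : Equiv.Perm (Fin i)),
      iteratedFDerivWithin ℝ i Φ (I ×ˢ Λ) (e₀, t₀) (v ∘ σ) = iteratedFDerivWithin ℝ i Φ (I ×ˢ Λ) (e₀, t₀) v :=
    fun v σ => iteratedFDerivWithin_comp_perm_of_mem_closure_interior hΦ hS hik h0 h00' v σ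
  have hpt : (fun _ : Fin i => ((e, lam) : ℝ × ℝ)) = fun _ => e • ((1 : ℝ), (0 : ℝ)) + lam • ((0 : ℝ), (1 : ℝ)) := by
    funext _
    rw [Prod.smul_mk, Prod.smul_mk, Prod.mk_add_mk, smul_eq_mul, smul_eq_mul, smul_eq_mul, smul_eq_mul, mul_one,
      mul_zero, mul_zero, mul_one, add_zero, zero_add]
  rw [hpt, map_const_add_smul_eq_sum_choose_of_symmetric _ hsymm, Finset.mul_sum]
  refine Finset.sum_congr rfl fun α hα => ?_
  have hαi : α ≤ i := Nat.lt_succ_iff.1 (Finset.mem_range.1 hα)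
  have hαβ : ((α + (i - α) : ℕ) : WithTop ℕ∞) ≤ ((k + 1 : ℕ) : WithTop ℕ∞) := by
    rw [Nat.add_sub_cancel' hαi]; exact hik
  rw [smul_eq_mul, iteratedFDerivWithin_ite_eq_append _ _ _ _ _ (Nat.add_sub_cancel' hαi),
    ← iteratedDerivWithin_iteratedDerivWithin_slice_snd_eq_append_prod hΦ hIu hΛu hαβ he₀ ht₀]
  have hfac : (i.factorial : ℝ) = (i.choose α : ℝ) * (α.factorial : ℝ) * ((i - α).factorial : ℝ) := by
    rw [← Nat.choose_mul_factorial_mul_factorial hαi]; push_cast; ring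
  have hα0 : (α.factorial : ℝ) ≠ 0 := by exact_mod_cast α.factorial_ne_zero
  have hβ0 : ((i - α).factorial : ℝ) ≠ 0 := by exact_mod_cast (i - α).factorial_ne_zero
  have hc0 : (i.choose α : ℝ) ≠ 0 := by exact_mod_cast (Nat.choose_pos hαi).ne'
  rw [hfac]
  field_simp

/-- **Taylor's formula with Lagrange remainder within a slab with an open first factor, in the mixed-partials
indexing**: for `Φ : ℝ × ℝ → ℝ` of class `C^{k+1}` within `I ×ˢ Λ` (`I` open convex, `Λ` convex of unique
differentiability), `e₀ ∈ I`, `t₀ ∈ Λ ∩ closure (interior Λ)` (e.g. `t₀ = 0 ∈ Λ = [0, δ)`), and increments with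
`e₀ + e ∈ I`, `t₀ + λ ∈ Λ`, there is `θ ∈ (0, 1)` with
`Φ(e₀ + e, t₀ + λ) = Σ_{i ≤ k} Σ_{α ≤ i} e^α λ^{i−α}/(α!(i−α)!) · ∂^α_e∂^{i−α}_{s,Λ}Φ(e₀, t₀)
  + D^{k+1}_{I×Λ}Φ(e₀ + θe, t₀ + θλ)((e, λ), …, (e, λ))/(k+1)!`,
the `e`-derivatives unconstrained — a double expansion `Σ e^α λ^β c_{(α,β)}` with one-sided `λ`-derivatives at
`t₀`, plus an explicit remainder. (folklore, Mathlib-level) [cite: Coleman2012, §5.1 Thm. 5.3] -/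
theorem taylor_lagrange_mixed_partials_openFst {Φ : ℝ × ℝ → ℝ} {I Λ : Set ℝ} (hI : IsOpen I) (hIc : Convex ℝ I)
    (hΛc : Convex ℝ Λ) (hΛu : UniqueDiffOn ℝ Λ) {e₀ t₀ : ℝ} (he₀ : e₀ ∈ I) (ht₀ : t₀ ∈ Λ)
    (ht₀' : t₀ ∈ closure (interior Λ)) {k : ℕ} (hΦ : ContDiffOn ℝ ((k + 1 : ℕ) : WithTop ℕ∞) Φ (I ×ˢ Λ))
    {e lam : ℝ} (he : e₀ + e ∈ I) (hlam : t₀ + lam ∈ Λ) :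
    ∃ θ ∈ Ioo (0 : ℝ) 1,
      Φ (e₀ + e, t₀ + lam) = ∑ i ∈ Finset.range (k + 1), ∑ α ∈ Finset.range (i + 1),
          (1 / ((α.factorial : ℝ) * ((i - α).factorial : ℝ)) * e ^ α * lam ^ (i - α)) *
            iteratedDeriv α (fun u => iteratedDerivWithin (i - α) (fun s => Φ (u, s)) Λ t₀) e₀
        + (((k + 1).factorial : ℝ))⁻¹ *
            iteratedFDerivWithin ℝ (k + 1) Φ (I ×ˢ Λ) (e₀ + θ * e, t₀ + θ * lam) (fun _ => (e, lam)) := by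
  have he₀' : e₀ ∈ closure (interior I) := by
    rw [hI.interior_eq]
    exact subset_closure he₀
  obtain ⟨θ, hθ, h⟩ :=
    taylor_lagrange_mixed_partials_prod hIc hI.uniqueDiffOn hΛc hΛu he₀ he₀' ht₀ ht₀' hΦ he hlam
  refine ⟨θ, hθ, ?_⟩
  rw [h]
  congr 1
  refine Finset.sum_congr rfl fun i _ => Finset.sum_congr rfl fun α _ => ?_
  rw [iteratedDerivWithin_of_isOpen hI he₀]

end MixedPartialsForm


end Literature.Analysis.Calculus

end
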